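import Summits.ResolutionOfSingularities.ResolutionOfSingularities.Theorems.HilbertSamuelEliminationSigmaMaxModificationsDimThreeIsolated
import Literature.AlgebraicGeometry.Resolution.RegularLocusDense
import Literature.AlgebraicGeometry.Resolution.HilbertSamuelIsolatedSingularities
import Literature.AlgebraicGeometry.Resolution.HilbertSamuelLowerBound
import Literature.AlgebraicGeometry.Resolution.ExcellentRingsFieldProofs
import Literature.Topology.KrullDimZero
import Literature.Topology.KrullDimensionDrop
import Mathlib.AlgebraicGeometry.Morphisms.Proper
import Mathlib.AlgebraicGeometry.Noetherian
import HarnessLib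

/-!
# `SigmaMaxModifications` (crux stmt-ResolutionOfSingularities-18506, line `Sketch`):
# stub `stub_curve` — the crux body for CURVES, from curve resolutions

Stub `stub_curve` of the lead skeleton `Sketch` (reshape 2, graded by dimension) for the crux
`Summit.ResolutionOfSingularities.ResolutionOfSingularities.Theses.HilbertSamuelElimination.SigmaMaxModifications`
(Cossart–Jannsen–Saito, LNM 2270, Def. 6.15: `Σ^max`-modifications). If every reduced separated
excellent Noetherian scheme of dimension `≤ 1` has a resolution of singularities which is an
isomorphism over (an open equal to) its regular locus, then every reduced separated non-regular
`X/k` of finite type with `dim X ≤ 1` has a `Σ^max`-modification at every level `N ≥ dim X`.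

Proof. For a reduced quasi-excellent Noetherian scheme `X` of dimension `≤ 1` the singular
locus `Sing X = X ∖ Reg X` is a FINITE SET OF CLOSED POINTS
(`finite_compl_regularLocus_of_dim_le_one`): it is closed (J-2,
`Scheme.isOpen_regularLocus_of_isQuasiExcellent`) and misses every maximal point (the local ring
of a reduced scheme at a maximal point is a field, `Scheme.genericPoints_subset_regularLocus`),
so every point of it is a proper specialisation of a point outside it and its dimension drops
below `1` (`Literature.Topology.topologicalKrullDim_lt_of_forall_exists_specializes`); a closed
subset of dimension `≤ 0` of a Noetherian sober space consists of finitely many closed points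
(`finite_and_isClosed_singleton_of_dim_le_one_of_forall_genericPoints`). Hence
`X_max ⊆ Sing X` is closed (`Scheme.isClosed_hsMaxLocus_of_finite_compl_regularLocus`,
CJS Lemma 2.36 (a) for isolated singularities) and `Sing X ∖ X_max` is closed, so disjoint from
`X_max` together with its closure; the landed gluing theorem
`sigmaMaxModifications_of_isolated_of_resolutions 1` (resolve the open neighbourhood
`X ∖ (Sing X ∖ X_max)` of `X_max`, glue with the identity on `X ∖ X_max`) concludes.

## Sources

* V. Cossart, U. Jannsen, S. Saito, *Desingularization: Invariants and Strategy*, LNM 2270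
  (2020), Def. 6.15, Lemma 2.36, Rem. 6.29. [CossartJannsenSaito2020]
* J. Kollár, *Lectures on Resolution of Singularities* (2007), §1.4 (curves: the singular
  locus is a finite set of closed points). [Kollar2007]
-/

set_option linter.dupNamespace false -- mandated namespace of this single-conjunct summit

noncomputable section

open CategoryTheory AlgebraicGeometry TopologicalSpace
open Literature.AlgebraicGeometry.Resolution Literature.RingTheory.HilbertSamuel

namespace Summit.ResolutionOfSingularities.ResolutionOfSingularities.Theorems.SigmaMaxModifications.Sketch

/-! ## Topology: closed sets missing the maximal points of a space of dimension `≤ 1` -/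

/-- **A closed subset of a sober Noetherian `T₀` space of dimension `≤ 1` which contains no
maximal point (generic point of an irreducible component) is a finite set of closed points.**
Every point `z ∈ Z` is a specialisation of the generic point of an irreducible component through
`z`, which lies outside `Z`, so `dim Z < 1`
(`Literature.Topology.topologicalKrullDim_lt_of_forall_exists_specializes`); a closed subset of
dimension `≤ 0` has only closed points, and it is the finite union of its irreducible closed
subsets, each the closure of its generic point, i.e. a single closed point. [folklore] -/
theorem finite_and_isClosed_singleton_of_dim_le_one_of_forall_genericPoints
    {X : Type*} [TopologicalSpace X] [QuasiSober X] [T0Space X] [NoetherianSpace X]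
    (hdim : topologicalKrullDim X ≤ 1) {Z : Set X} (hZ : IsClosed Z)
    (hZ' : ∀ x ∈ genericPoints X, x ∉ Z) :
    Z.Finite ∧ ∀ p ∈ Z, IsClosed ({p} : Set X) := by
  -- `dim Z < 1`: every point of `Z` is a specialisation of a maximal point, which is not in `Z`
  have hlt : topologicalKrullDim Z < ((1 : ℕ) : WithBot ℕ∞) := by
    refine Literature.Topology.topologicalKrullDim_lt_of_forall_exists_specializes isClosed_univ
      hZ (Set.subset_univ Z) (fun z _ => ?_) 1 ?_
    · let c : irreducibleComponents X :=
        ⟨irreducibleComponent z, irreducibleComponent_mem_irreducibleComponents z⟩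
      exact ⟨(genericPoints.ofComponent c).1, Set.mem_univ _,
        hZ' _ (genericPoints.ofComponent c).2,
        (genericPoints.isGenericPoint_ofComponent c).specializes mem_irreducibleComponent⟩
    · rw [IsHomeomorph.topologicalKrullDim_eq _ (Homeomorph.Set.univ X).isHomeomorph]
      exact lt_of_le_of_lt hdim (by exact_mod_cast WithBot.coe_lt_coe.mpr (by decide))
  have h0 : topologicalKrullDim Z ≤ 0 := by
    have h1 : topologicalKrullDim Z < 1 := by exact_mod_cast hlt
    rw [← zero_add (1 : WithBot ℕ∞), ← Nat.cast_zero, ENat.WithBot.lt_add_one_iff] at h1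
    rwa [← Nat.cast_zero]
  have hcl : ∀ p ∈ Z, IsClosed ({p} : Set X) := fun p hp =>
    Literature.Topology.Set.isClosed_singleton_of_topologicalKrullDim_le_zero hZ h0 hp
  refine ⟨?_, hcl⟩
  -- `Z` is a finite union of irreducible closed sets, each the closure of a (closed) point
  obtain ⟨F, hFfin, hFcl, hFirr, hZF⟩ := NoetherianSpace.exists_finite_set_isClosed_irreducible hZ
  have hfin : (⋃₀ F).Finite := by
    refine hFfin.sUnion fun C hC => ?_
    obtain ⟨c, hc⟩ := QuasiSober.sober (hFirr C hC) (hFcl C hC)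
    have hcZ : c ∈ Z := by
      rw [hZF]
      exact Set.mem_sUnion_of_mem hc.mem hC
    have hC1 : C = {c} := by rw [← hc.def, (hcl c hcZ).closure_eq]
    rw [hC1]
    exact Set.finite_singleton c
  rwa [← hZF] at hfin

/-! ## The singular locus of a reduced quasi-excellent curve -/

universe u in
/-- **The singular locus of a reduced quasi-excellent Noetherian scheme of dimension `≤ 1` is a
finite set of closed points**: it is closed (J-2) and contains no maximal point (the local ring
of a reduced scheme at a maximal point is a field, hence regular). [cite: Kollar2007, §1.4]
[folklore] -/
theorem finite_compl_regularLocus_of_dim_le_one {X : Scheme.{u}} [IsReduced X] [IsNoetherian X]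
    (hqe : Scheme.IsQuasiExcellent X) (hdim : topologicalKrullDim X ≤ 1) :
    (Scheme.regularLocus X)ᶜ.Finite ∧ ∀ x ∈ (Scheme.regularLocus X)ᶜ, IsClosed ({x} : Set X) :=
  finite_and_isClosed_singleton_of_dim_le_one_of_forall_genericPoints hdim
    (Scheme.isOpen_regularLocus_of_isQuasiExcellent hqe).isClosed_compl
    fun _ hx hxS => hxS (Scheme.genericPoints_subset_regularLocus X hx)

/-! ## The stub -/

/-- **The crux body for curves, from curve resolutions.** If reduced separated excellent
Noetherian schemes of dimension `≤ 1` have resolutions which are isomorphisms over the regular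
locus, then every reduced separated non-regular `X/k` of finite type with `dim X ≤ 1` has a
`Σ^max`-modification at every level `N ≥ dim X`: `Sing X` is a finite set of closed points, so
`X_max ⊆ Sing X` is closed and disjoint from the closure of `Sing X ∖ X_max`, and
`sigmaMaxModifications_of_isolated_of_resolutions 1` applies.
[cite: CossartJannsenSaito2020, Def. 6.15] [cite: Kollar2007, §1.4] -/
theorem stub_curve :
    (∀ (Y : Scheme.{0}) [Y.IsSeparated] [IsNoetherian Y] [IsReduced Y],
      Scheme.IsExcellent Y → topologicalKrullDim Y ≤ ((1 : ℕ) : WithBot ℕ∞) →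
        ∃ (Y' : Scheme.{0}) (ρ : Y' ⟶ Y), IsResolution ρ ∧
          ∃ V : Y.Opens, (V : Set Y) = Scheme.regularLocus Y ∧ IsIso (ρ ∣_ V)) →
    ∀ (k : Type) [Field k] (X : Scheme.{0}) (f : X ⟶ Spec (.of k)), IsSeparated f →
      LocallyOfFiniteType f → QuasiCompact f → IsReduced X → ¬ Scheme.IsRegular X →
      topologicalKrullDim X ≤ ((1 : ℕ) : WithBot ℕ∞) →
      ∀ N : ℕ, topologicalKrullDim X ≤ (N : WithBot ℕ∞) →
        ∃ (X' : Scheme.{0}) (π : X' ⟶ X), IsProper π ∧ IsReduced X' ∧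
          topologicalKrullDim X' ≤ (N : WithBot ℕ∞) ∧
          (∀ U : X.Opens, (U : Set X) ⊆ (Scheme.hsMaxLocus X N)ᶜ → IsIso (π ∣_ U)) ∧
          Dense ((fun x' => π.base x') ⁻¹' (Scheme.hsMaxLocus X N)ᶜ) ∧
          (∀ x' : X', Scheme.hsFun X' N x' ≤ Scheme.hsFun X N (π.base x')) ∧
          ∀ ν : ℕ → ℕ, Maximal (· ∈ Scheme.hsValues X N) ν → ν ∉ Scheme.hsValues X' N := by
  intro hRes k _ X f hsep hft hqc hred hreg hdim1 N hdim
  haveI := hsep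
  haveI := hft
  haveI := hqc
  haveI := hred
  haveI : IsLocallyNoetherian X := LocallyOfFiniteType.isLocallyNoetherian f
  haveI : IsNoetherian X := Scheme.isNoetherian_of_finiteType_over_field f
  have hqe : Scheme.IsQuasiExcellent X :=
    Scheme.isQuasiExcellent_of_locallyOfFiniteType Stacks07QW_field_holds f
  -- `Sing X` is a finite set of closed points
  obtain ⟨hSfin, hSpt⟩ :=
    finite_compl_regularLocus_of_dim_le_one hqe (by exact_mod_cast hdim1)
  have hstalk : ∀ x : X, ∃ d : ℕ, ringKrullDim (X.presheaf.stalk x) = d ∧ d ≤ N := fun x =>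
    exists_ringKrullDim_stalk_eq_of_topologicalKrullDim_le hdim x
  -- hence `X_max ⊆ Sing X` is closed and isolated from `Sing X ∖ X_max`
  have hcl : IsClosed (Scheme.hsMaxLocus X N) :=
    Scheme.isClosed_hsMaxLocus_of_finite_compl_regularLocus hstalk hSfin hSpt
  have hdisj : Disjoint (closure ((Scheme.regularLocus X)ᶜ \ Scheme.hsMaxLocus X N))
      (Scheme.hsMaxLocus X N) := by
    rw [(isClosed_of_finite_of_isClosed_singleton (hSfin.subset Set.sdiff_subset)
      fun x hx => hSpt x hx.1).closure_eq]
    exact Set.disjoint_sdiff_left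
  exact sigmaMaxModifications_of_isolated_of_resolutions 1 hRes f hreg hdim1 hdim hcl hdisj

end Summit.ResolutionOfSingularities.ResolutionOfSingularities.Theorems.SigmaMaxModifications.Sketch

end
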